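import Summits.CriticalPhenomena.PercolationContinuityZ3.Theorems.PercNearOneGluingNoHeavyLowerTailPcovJ1Base
import Summits.CriticalPhenomena.PercolationContinuityZ3.Theorems.PercNearOneGluingNoHeavyLowerTailMixMetaA2
import HarnessLib

/-!
# KN Question 8 at `|A| = 3`: the two-source inequality (J1-A2') and `J1 ≥ 0` — the COVARIANCE SIDE of PCOV

Support file (`--supports stmt-CriticalPhenomena-4575`, closed crux; independent mathematics on Kozma–Nitzan's Question 8 at
`|A| = 3`), prover `prim-hp-7` (gen 39).  No definitions, no named facts, no sorries; standard axioms.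
Memo `prim-ineq-gen-6/FINDING-G13.md` §8 (the joint-world split `PCOV margin = J1 + CEN`; (iii) "J1 has the META-A2 structure") and
`PROOF-STAR1.md` §4 ("What it gives: J1 ≥ 0, hence the covariance side of PCOV"); Lean plan (L3) there, completed here.

SETTING (finite-sum world framework of `CovTau`; world `U : Finset V`, product weights `w ∈ [0,1]^{Sym2 V}`): owner `x`, observer `o`,
marker `v` (`x ≠ v`), pocket-avoid set `Z ∋ x, v` (memo: `Z = {x,v} ∪ Y`), `Ψ` monotone nonnegative on vertex sets; the four world
functionals of `…PcovJ1World.lean`: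
  `⟨e⟩_N = CovTau.Eav w U {x} o v N = μ(o ↔ v, v ↮ {x} ∪ N)`,  `⟨α⟩_N = PcovJ1.Aw … N = μ(v ↮ {x} ∪ N, o ↮ Z ∪ N)`,
  `⟨h₁⟩_N = CovTau.Yw w U x (PcovJ1.Hw …) N = E[ Cov_{G ∖ C_{N∪{o}}}(Ψ(C_x), 1{x↔v}) ; x ↮ N, o ↮ Z ∪ N ]`,
  `⟨A⟩_N = CovTau.Yw w U x (B(·;o)) N = E[ Cov_{G ∖ C_N}(Ψ(C_x), 1{x↔o}) ; x ↮ N ]`.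

* `PcovJ1.j1A2` — **(J1-A2')**: for all `N, N' ⊆ U`,  `⟨e⟩_N · ⟨h₁⟩_{N'} ≤ ⟨α⟩_{N ∪ N'} · ⟨A⟩_{N ∩ N'}`.
  PROOF = `CovTau.metaA2_abstract` (van den Berg–Häggström–Kahn / Ahlswede–Daykin two-source induction) with admissibility
  `v ∈ U' ∧ v ∉ Z' ∧ x ∉ Z'`, the star decompositions `CovTau.Eav_step` / `CovTau.Yw_step` / `PcovJ1.Aw_step`, antitonicity
  `CovTau.Eav_antitone` / `PcovJ1.Yw_Hw_antitone`, and the base `PcovJ1.base` = (★₁) × (T2).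
* `PcovJ1.j1_diag`, `PcovJ1.j1_nonneg` — the diagonal `N = N' = Y`:  **J1 ≥ 0**, i.e.
  `⟨α⟩_Y·⟨A⟩_Y − ⟨e⟩_Y·⟨h₁⟩_Y ≥ 0` (`⟸⟹ ⟨A⟩_Y − p·⟨h₁⟩_Y ≥ 0`, `p = ⟨e⟩_Y/⟨α⟩_Y`, whenever `⟨α⟩_Y > 0`): the covariance side of the
  pocket covariance comparison PCOV (prim-lf-2 POCKET-CERT §3 = prim-ineq-gen-7 PCSH₀) in the split `PCOV = J1 + CEN` of FINDING-G13 §8.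
[cite: VandenbergHaggstromKahn2005, Thm. 1.1 (pp. 3–5), Thm. 1.4 (p. 7), Thm. 2.1 (p. 9), §1 identity (6) (p. 4)]
[cite: Gladkov2024, Thm. 3.2 (p. 4)] [cite: AhlswedeDaykin1978, Thm. 1] [cite: KozmaNitzan2024, Question 8 (§5.5 p. 36)]
-/

noncomputable section

namespace Summit.CriticalPhenomena.PercolationContinuityZ3.Theorems

namespace PcovJ1

open Literature.Probability.Percolation
open Literature.Probability.Percolation.BHK2006
open Literature.Probability.Percolation.DecisionTree (ind ind_of_mem ind_of_not_mem ind_nonneg)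
open CovTau
open scoped Classical

variable {V : Type*} [Fintype V]

/-- **(J1-A2') — the two-source inequality of the J1 route** (FINDING-G13 §8(iii)): for all `N, N' ⊆ U`,
`⟨e⟩_N · ⟨h₁⟩_{N'} ≤ ⟨α⟩_{N ∪ N'} · ⟨A⟩_{N ∩ N'}`.
[cite: VandenbergHaggstromKahn2005, Thm. 1.1 (pp. 3–5)] [cite: Gladkov2024, Thm. 3.2 (p. 4)]
[cite: KozmaNitzan2024, Question 8 (§5.5 p. 36)] -/
theorem j1A2 (w : Sym2 V → ℝ) (hw0 : ∀ e, 0 ≤ w e) (hw1 : ∀ e, w e ≤ 1) (hm : ∑ ω, weight w ω = 1)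
    {x o v : V} (hxv : x ≠ v) {Z : Set V} (hxZ : x ∈ Z) (hvZ : v ∈ Z)
    {Ψ : Set V → ℝ} (hΨ : ∀ S T : Set V, S ⊆ T → Ψ S ≤ Ψ T) (hΨ0 : ∀ S, 0 ≤ Ψ S) (U : Finset V) :
    ∀ N N' : Set V, N ⊆ ↑U → N' ⊆ ↑U →
      Eav w U {x} o v N * Yw w U x (Hw w x o v Z Ψ) N' ≤
        Aw w U x o v Z (N ∪ N') * Yw w U x (fun U'' => Bf w U'' x o Ψ) (N ∩ N') := by
  have hH0 : ∀ U'' : Finset V, 0 ≤ Hw w x o v Z Ψ U'' := fun U'' => Hw_nonneg hw0 hw1 hm x o v Z hΨ hΨ0 U''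
  have hB0 : ∀ U'' : Finset V, 0 ≤ Bf w U'' x o Ψ := fun U'' => Bf_nonneg hw0 hw1 hm U'' x o hΨ hΨ0
  refine metaA2_abstract w hw0 hw1 hm (fun U' Z' => v ∈ U' ∧ v ∉ Z' ∧ x ∉ Z')
    (fun U' N => Eav w U' {x} o v N) (fun U' N => Yw w U' x (Hw w x o v Z Ψ) N) (fun U' N => Aw w U' x o v Z N)
    (fun U' N => Yw w U' x (fun U'' => Bf w U'' x o Ψ) N)
    (fun U' N => Eav_nonneg hw0 hw1 U' {x} o v N) (fun U' N => Yw_nonneg hw0 hw1 U' x hH0 N)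
    (fun U' N => Aw_nonneg hw0 hw1 U' x o v Z N) (fun U' N => Yw_nonneg hw0 hw1 U' x hB0 N) U
    ?_ ?_ ?_ ?_ ?_ ?_ ?_ ?_
  · -- admissibility from non-vanishing
    intro U' _ N N' _ _ hne Z' _ hZ'
    have h1 : Eav w U' {x} o v N ≠ 0 := fun h => hne (by rw [h, zero_mul])
    have h2 : Yw w U' x (Hw w x o v Z Ψ) N' ≠ 0 := fun h => hne (by rw [h, mul_zero])
    have hvU' : v ∈ U' := by
      by_contra hv
      exact h2 (Yw_eq_zero_of_not_mem w x (fun U'' hU'' => Hw_eq_zero_of_not_mem w (Ne.symm hxv) Z Ψ hU'') hv N')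
    have hvN : v ∉ ({x} : Set V) ∪ N := fun hv => h1 (Eav_eq_zero_of_mem w U' {x} o v hv)
    have hxN' : x ∉ N' := fun hx => h2 (Yw_eq_zero_of_mem w U' x _ hx)
    exact ⟨hvU', fun hvZ' => hvN (Or.inr (hZ' (Finset.mem_coe.2 hvZ')).1),
      fun hxZ' => hxN' (hZ' (Finset.mem_coe.2 hxZ')).2⟩
  · intro U' _ Z' hZU' hAdm _ N hZN _
    exact Eav_step hZU' hAdm.1 hAdm.2.1 hZN w hm o
  · intro U' _ Z' hZU' hAdm _ N hZN _
    exact Yw_step hZU' hAdm.2.2 hZN w hm _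
  · intro U' _ Z' hZU' hAdm _ N hZN _
    exact Aw_step hZU' hAdm.1 hAdm.2.1 hZN w hm x o Z
  · intro U' _ Z' hZU' hAdm _ N hZN _
    exact Yw_step hZU' hAdm.2.2 hZN w hm _
  · intro U' _ N N' hNN' _
    exact Eav_antitone hw0 hw1 U' {x} o v hNN'
  · intro U' _ N N' hNN' hN'U'
    exact Yw_Hw_antitone w hw0 hw1 hm U' x o v Z hΨ hΨ0 hNN' hN'U'
  · -- disjoint sources: (★₁) × (T2)
    intro U' _ N N' _ _ _
    rw [Yw_empty w hm]
    exact base w hw0 hw1 hm U' hxv hxZ hvZ hΨ hΨ0 N N'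

/-- **J1 ≥ 0, product form** (the diagonal `N = N' = Y` of (J1-A2')): `⟨e⟩_Y · ⟨h₁⟩_Y ≤ ⟨α⟩_Y · ⟨A⟩_Y`.
[cite: VandenbergHaggstromKahn2005, Thm. 1.1 (pp. 3–5)] [cite: KozmaNitzan2024, Question 8 (§5.5 p. 36)] -/
theorem j1_diag (w : Sym2 V → ℝ) (hw0 : ∀ e, 0 ≤ w e) (hw1 : ∀ e, w e ≤ 1) (hm : ∑ ω, weight w ω = 1)
    {x o v : V} (hxv : x ≠ v) {Z : Set V} (hxZ : x ∈ Z) (hvZ : v ∈ Z)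
    {Ψ : Set V → ℝ} (hΨ : ∀ S T : Set V, S ⊆ T → Ψ S ≤ Ψ T) (hΨ0 : ∀ S, 0 ≤ Ψ S) (U : Finset V)
    {Y : Set V} (hY : Y ⊆ ↑U) :
    Eav w U {x} o v Y * Yw w U x (Hw w x o v Z Ψ) Y ≤ Aw w U x o v Z Y * Yw w U x (fun U'' => Bf w U'' x o Ψ) Y := by
  have h := j1A2 w hw0 hw1 hm (o := o) hxv hxZ hvZ hΨ hΨ0 U Y Y hY hY
  simpa only [Set.union_self, Set.inter_self] using h

/-- **J1 ≥ 0** (FINDING-G13 §8 / PROOF-STAR1 §4: the covariance side of PCOV):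
`⟨α⟩_Y · ⟨A⟩_Y − ⟨e⟩_Y · ⟨h₁⟩_Y ≥ 0`, i.e. `⟨A⟩_Y ≥ p · ⟨h₁⟩_Y` with `p = ⟨e⟩_Y / ⟨α⟩_Y` whenever `⟨α⟩_Y > 0`.
[cite: VandenbergHaggstromKahn2005, Thm. 1.1 (pp. 3–5)] [cite: Gladkov2024, Thm. 3.2 (p. 4)]
[cite: KozmaNitzan2024, Question 8 (§5.5 p. 36)] -/
theorem j1_nonneg (w : Sym2 V → ℝ) (hw0 : ∀ e, 0 ≤ w e) (hw1 : ∀ e, w e ≤ 1) (hm : ∑ ω, weight w ω = 1)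
    {x o v : V} (hxv : x ≠ v) {Z : Set V} (hxZ : x ∈ Z) (hvZ : v ∈ Z)
    {Ψ : Set V → ℝ} (hΨ : ∀ S T : Set V, S ⊆ T → Ψ S ≤ Ψ T) (hΨ0 : ∀ S, 0 ≤ Ψ S) (U : Finset V)
    {Y : Set V} (hY : Y ⊆ ↑U) :
    0 ≤ Aw w U x o v Z Y * Yw w U x (fun U'' => Bf w U'' x o Ψ) Y - Eav w U {x} o v Y * Yw w U x (Hw w x o v Z Ψ) Y :=
  sub_nonneg.2 (j1_diag w hw0 hw1 hm hxv hxZ hvZ hΨ hΨ0 U hY)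

/-- **J1 ≥ 0, ratio form**: if `⟨α⟩_Y > 0` then `p · ⟨h₁⟩_Y ≤ ⟨A⟩_Y` with `p = ⟨e⟩_Y / ⟨α⟩_Y`
(FINDING-G13 §8: `J1 := ⟨A⟩_Y − p·⟨h₁⟩_Y ≥ 0`). [cite: KozmaNitzan2024, Question 8 (§5.5 p. 36)] -/
theorem j1_ratio (w : Sym2 V → ℝ) (hw0 : ∀ e, 0 ≤ w e) (hw1 : ∀ e, w e ≤ 1) (hm : ∑ ω, weight w ω = 1)
    {x o v : V} (hxv : x ≠ v) {Z : Set V} (hxZ : x ∈ Z) (hvZ : v ∈ Z)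
    {Ψ : Set V → ℝ} (hΨ : ∀ S T : Set V, S ⊆ T → Ψ S ≤ Ψ T) (hΨ0 : ∀ S, 0 ≤ Ψ S) (U : Finset V)
    {Y : Set V} (hY : Y ⊆ ↑U) (hα : 0 < Aw w U x o v Z Y) :
    Eav w U {x} o v Y / Aw w U x o v Z Y * Yw w U x (Hw w x o v Z Ψ) Y ≤
      Yw w U x (fun U'' => Bf w U'' x o Ψ) Y := by
  rw [div_mul_eq_mul_div, div_le_iff₀ hα, mul_comm (Yw w U x _ Y) (Aw w U x o v Z Y)]
  exact j1_diag w hw0 hw1 hm hxv hxZ hvZ hΨ hΨ0 U hY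

end PcovJ1

end Summit.CriticalPhenomena.PercolationContinuityZ3.Theorems

end
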